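import Summits.QuantumFields.YangMills.Theses.EntropyBudgetEquipartition
import Summits.QuantumFields.YangMills.Theorems.EquipartitionCriticalityFreeEnergyLogCoefficient
import Summits.QuantumFields.YangMills.Theorems.EntropyBudgetEquipartitionFreeEnergyRateStubMaxwellRate
import Summits.QuantumFields.YangMills.Theorems.EntropyBudgetEquipartitionFreeEnergyRateStubUpperRate
import Summits.QuantumFields.YangMills.Theorems.EntropyBudgetEquipartitionFreeEnergyRateStubLowerRate
import Summits.QuantumFields.YangMills.Theorems.EntropyBudgetEquipartitionFreeEnergyRateStubTransfer
import HarnessLib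

/-!
# `FreeEnergyRate` (crux `stmt-QuantumFields-22402`, route `EntropyBudgetEquipartition`) — the crux proof (line `birth`, reshaped)

Crux: for every compact simple `G` and faithful unitary lattice representation `r`,
`|f_r(β) + (3 D/2) log β − K| ≤ C β^(−κ)` for `β ≥ β₀` (`D = dim_ℝ 𝔤_r`), i.e. Chatterjee's two-term
free-energy asymptotics (arXiv:1602.01222, Thm. 2.1; in the tree for every such `(G, r)` as
`Summit.QuantumFields.YangMills.Theorems.freeEnergyLogCoefficient_proof`) WITH A POWER RATE.

LINE `birth` (ideator ym-idea-3: lower rate + upper rate against Chatterjee's constant), reshaped by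
the lead along the tree's mechanised proof of Theorem 2.1: every error term of the §17 joint limit
(`OneBoxBounds.eventually_T_le`, `eventually_le_T`) is an explicit negative power of `β`, so the
two one-sided rates are proved at the level of the ABSTRACT one-box interface `B : OneBoxBounds d`
(stubs `stub_upperRate`, `stub_lowerRate`), fed by a rate for the lattice Maxwell free energy
(`stub_maxwellRate`, from the dyadic Cauchy estimates of `LatticeMaxwellFreeEnergyLimit`), and
transferred to the torus density at fixed `β` by letting the cube side `n → ∞`
(`stub_transfer`, boundary-condition independence). The four stubs are proved in the imported
sibling files `EntropyBudgetEquipartitionFreeEnergyRateStub*.lean` (the lower rate by a parallel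
stub seat); this file is the composition `FreeEnergyRate_of` and the canonical alias
`freeEnergyRate_proof`. HONEST LABEL: the YM mass gap is NOT proved by any of this (the crux is an
input of route `EntropyBudgetEquipartition`, which targets the RECORD-label rung R2ξ-G `XiPow`, an
upper bound on the lattice gap, not the Clay statement).
-/

noncomputable section

namespace Summit.QuantumFields.YangMills.Theorems.FreeEnergyRate

open scoped Matrix.Norms.Frobenius ENNReal NNReal
open MeasureTheory Measure Filter Topology Set
open Literature.Probability.LatticeModels Literature.MathematicalPhysics.QuantumLattice
open Literature.MathematicalPhysics.QuantumFieldTheory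
open Summit.QuantumFields.YangMills.Theorems.FreeEnergyLogCoefficient

/-! ## The stubs of line `birth`

All four registered stubs (`stub_maxwellRate`, `stub_upperRate`, `stub_lowerRate`, `stub_transfer`)
are proved in the imported sibling files `EntropyBudgetEquipartitionFreeEnergyRateStub*.lean`. -/

/-- **The crux from the stubs.** The one-box interface of `r.ρ` in the
exponential chart (`exists_oneBoxBounds`), the Maxwell limit `L` (`LatticeMaxwell.tendsto_logZM_div`)
with its rate (`stub_maxwellRate`), the two one-sided quantitative joint bounds (`stub_upperRate`,
`stub_lowerRate`, combined at `κ = min κ₁ κ₂` for `β ≥ 1`), the identification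
`T(B_n, β) = F(B_n, β) + ½(3 − 4/n + n^{−4}) D log β` (`coef_eq`) and the transfer to the torus
(`stub_transfer`) prove the crux with `K = 3 log c_H + D L`. [cite: arXiv160201222, Thm. 2.1] -/
theorem FreeEnergyRate_of :
    Summit.QuantumFields.YangMills.Theses.EntropyBudgetEquipartition.FreeEnergyRate := by
  intro G _ _ _ _ hG
  letI : MeasurableSpace G := borel G
  haveI : BorelSpace G := ⟨rfl⟩
  intro r
  haveI : SecondCountableTopology (Matrix (Fin r.N) (Fin r.N) ℂ) :=
    inferInstanceAs (SecondCountableTopology (Fin r.N → Fin r.N → ℂ))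
  haveI : SecondCountableTopology G :=
    (r.continuous.isClosedEmbedding r.injective).isEmbedding.secondCountableTopology
  obtain ⟨B, hBlog, hBD⟩ :=
    exists_oneBoxBounds (d := 4) r.ρ (by norm_num) r.continuous r.injective r.mem_unitary
  obtain ⟨L, hL⟩ := LatticeMaxwell.tendsto_logZM_div (d := 4) (by norm_num)
  obtain ⟨CM, hCM⟩ := stub_maxwellRate (d := 4) (by norm_num) hL
  obtain ⟨κ₁, hκ₁, hU⟩ := stub_upperRate (d := 4) (by norm_num) B hCM
  obtain ⟨κ₂, hκ₂, hLow⟩ := stub_lowerRate (d := 4) (by norm_num) B hCM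
  have hdim : dimE r.ρ = Module.finrank ℝ ↥(repLieAlgebra r) :=
    (stub_expChartPackage r.ρ r.continuous r.injective r.mem_unitary).2.2.2.1
  -- the two-sided bound in free-energy form, at `κ = min κ₁ κ₂`
  have htwo : ∀ᶠ β : ℝ in atTop, ∀ᶠ n : ℕ in atTop,
      |freeEnergyPerSite r.ρ β (halfOpenBox 4 n) +
          (1 / 2) * ((4 : ℝ) - 1 - 4 / n + 1 / (n : ℝ) ^ 4) * (B.D : ℝ) * Real.log β -
          ((((4 : ℕ) : ℝ) - 1) * Real.log B.cH + (B.D : ℝ) * L)| ≤ β ^ (-(min κ₁ κ₂)) := by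
    filter_upwards [hU, hLow, eventually_ge_atTop (1 : ℝ)] with β hu hl hβ1
    filter_upwards [hu, hl, eventually_ge_atTop (1 : ℕ)] with n hun hln hn1
    have hT : B.T n β = freeEnergyPerSite r.ρ β (halfOpenBox 4 n) +
        (1 / 2) * ((4 : ℝ) - 1 - 4 / n + 1 / (n : ℝ) ^ 4) * (B.D : ℝ) * Real.log β := by
      rw [OneBoxBounds.T, OneBoxBounds.F, hBlog, ChatterjeeJointLimit.coef_eq (by norm_num) hn1,
        ChatterjeeFreeEnergy.freeEnergyPerSite_halfOpenBox_eq]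
      push_cast
      ring
    have hm₁ : β ^ (-κ₁) ≤ β ^ (-(min κ₁ κ₂)) :=
      Real.rpow_le_rpow_of_exponent_le hβ1 (by simp)
    have hm₂ : β ^ (-κ₂) ≤ β ^ (-(min κ₁ κ₂)) :=
      Real.rpow_le_rpow_of_exponent_le hβ1 (by simp)
    rw [← hT, abs_le]
    constructor
    · linarith
    · linarith
  obtain ⟨K, κ, C, β₀, hκ, hb⟩ := stub_transfer r (hBD.trans hdim) (lt_min hκ₁ hκ₂) htwo
  exact ⟨K, κ, C, β₀, hκ, hb⟩

end Summit.QuantumFields.YangMills.Theorems.FreeEnergyRate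

namespace Summit.QuantumFields.YangMills.Theorems

/-- **Crux `FreeEnergyRate` of route `EntropyBudgetEquipartition`** (Chatterjee's Theorem 2.1 with a
power rate, for every compact group with a faithful unitary lattice representation, torus
normalisation, `d = 4`): `∀ G` compact simple Lie, `∀ r : LatticeRep G`, `∃ K κ C β₀`, `0 < κ` and
`|f_r(β) + (3D/2) log β − K| ≤ C β^{−κ}` for `β ≥ β₀`. Not a statement about the mass gap. [cite: arXiv160201222, Thm. 2.1] -/
theorem freeEnergyRate_proof :
    Summit.QuantumFields.YangMills.Theses.EntropyBudgetEquipartition.FreeEnergyRate :=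
  FreeEnergyRate.FreeEnergyRate_of

end Summit.QuantumFields.YangMills.Theorems

end
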